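import Summits.BirchSwinnertonDyer.Rank1Residual.O5.O5GlobalLine
import Summits.BirchSwinnertonDyer.Rank1Residual.Additive.LocIrrOddPrimes
import Literature.NumberTheory.EllipticCurves.BSDRankZeroDensityProofs
import HarnessLib

/-!
# O5 — the edge T23b ⟹ T23c with its classical binders DISCHARGED: `hpow`, `hgss` from the tree,
# `hpar` from the registered parity fact by name (cell `b2b-bsdres`, lane CLASS-CLOSURE, class O5;
# harvest seat 2, GEN 48, E102, part 2/3)

HONEST FRAMING (cell `b2b-bsdres`, run/shared/lean/b2b/bsd-rank1-residual/, verbatim in every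
file): the goal of the cell is to DELETE the COMBINATION-SHAPED residual classes of the
Birch–Swinnerton-Dyer formula for ALL analytic-rank `≤ 1` elliptic curves over `ℚ` — "full BSD
formula for every rank `≤ 1` curve in class `C`" assembled STRICTLY from published theorems — so
that the rank-`≤ 1` remainder becomes exactly the CONSTRUCTION-SHAPED classes, which are TYPED
(missing-input `Prop`s), NOT attempted. This is not "finishing BSD". Lane CLASS-CLOSURE: research
routes; no claim beyond the stated classes; nothing is booked here; no mark of `RESIDUAL-MAP.md`
moves; census numbers are EVIDENCE. THEOREMS ONLY (no definition, no named fact, no conjecture node;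
net named-fact debt `0`); every published theorem enters as one of the tree's existing named
Literature facts BY NAME; the node file `O5/O5GlobalLine.lean` (o5-r1 GEN 7 / cc-typer-5 GEN 8) is
not touched.

## What this file does

`O5/O5GlobalLine.lean` §3 records the PROVED edge `rootNumberTwisted_of_jump`: T23b
(`SelmerJumpTwistedClassesThree`, the exact `±1` jump of `#Sel₃` across a clean mod-3 congruence
III ↔ I₀*-ss) ⟹ T23c (`RootNumberTwistedClassesThree`, opposite global root numbers), modulo three
binders "in the shape in which they will be instantiated from the tree":

* `hpow` — `#Sel₃(E)` is a power of `3`: the tree THEOREM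
  `Literature.NumberTheory.EllipticCurves.exists_natCard_selmerGroup_eq_pow` (`BSDRankZeroDensity.lean`);
* `hgss` — an O5 curve on `(G) ∧ ss` is locally irreducible at `3`: the tree THEOREM
  `Additive.locIrr_three_of_classO5_of_subGss` (part 1/2, `Additive/LocIrrOddPrimes.lean`: Serre 1972
  Prop. 12 local form + the `p* = −3` twist dictionary of `O5/GssSplitThree.lean`);
* `hpar` — "`w(E) = 1 ↔ dim_{𝔽₃} Sel₃(E)` even" for `LocIrr` curves: Cassels–Tate
  [cite: MazurRubin2007, Prop. 2.1] + 3-parity [cite: DokchitserDokchitserAnnals2010, Thm. 1.4] — i.e.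
  the `p`-SELMER PARITY THEOREM, which the tree holds as the named Literature fact
  `Literature.NumberTheory.EllipticCurves.even_selmerRank_sub_torsionRank_iff`
  (`BSDRankZeroDensity.lean`: `#Sel_p = p^s`, `#E(ℚ)[p] = p^t ⟹ (Even (s − t) ↔ w(E) = 1)`,
  [cite: DokchitserDokchitserAnnals2010, Thm 1.4] in the `p`-Selmer form
  [cite: BhargavaShankarTernary2015, Thm 42]), applied with `t = 0` because a `LocIrr` curve has no
  rational `3`-torsion (`Additive.natCard_torsionBy_eq_one_of_locIrr`, part 1/2).

Hence **`rootNumberTwisted_of_jump_of_selmerParity`**: granted the ONE named fact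
`even_selmerRank_sub_torsionRank_iff`, T23b ⟹ T23c with no other binder; and, in the node's own
listed inputs, **`rootNumberTwisted_of_jump_of_pParity`**: granted `p_parity` (bsd.S19, the
Dokchitsers' corank form [cite: DokchitserDokchitserAnnals2010, Thm. 1.4]) and the Cassels–Tate
pairing `WeierstrassCurve.exists_casselsTate_pairing` (bsd.S18 = registry A24
[cite: MazurRubin2007, Prop. 2.1] for the parity use), through the tree's
`even_selmerRank_sub_torsionRank_iff_of_facts` (`BSDRankZeroDensityProofs.lean`, which PROVES the
`p`-Selmer form from those two). The same bookkeeping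
gives the sibling edge T23a ⟹ T23c′ (`rootNumberTame_of_transfer_of_selmerParity`): equal `#Sel₃`
⟹ equal root numbers, for pairs in which BOTH members are `LocIrr` at `3` — automatic on the I₀*
class (`SubGss`, part 1/2), an explicit binder `LocIrr X 3` otherwise (on III / III* the node
T23c′ lists `LocIrr W 3` only; `ρ̄_X ≅ ρ̄_W` from the congruence by Brauer–Nesbitt–Chebotarev, which
would transfer it, is not a tree theorem).

T23b and T23a themselves stay `@[conjecture]` THEOREM-CANDIDATES (o5-r1 GEN 7; Greenberg–Wiles +
Poitou–Tate, derivation `HOME/b2b-bsdres-o5-r1/gen7/T23-GLOBAL-LINE.md`, check E92): nothing here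
asserts them. EVIDENCE (census cell O5, P-K12 arms B/C, o5-r1 GEN 7): clean III~I₀* pairs 974 / 974
opposite rank parity; same-class clean pairs 2 292 / 2 292 equal parity.

References: T. Dokchitser, V. Dokchitser, Ann. of Math. 172 (2010) Thm. 1.4
[DokchitserDokchitserAnnals2010]; M. Bhargava, A. Shankar, Ann. of Math. 181 (2015) Thm. 42
[BhargavaShankarTernary2015]; B. Mazur, K. Rubin, Ann. of Math. 166 (2007) Prop. 2.1 [MazurRubin2007];
J.-P. Serre, Invent. Math. 15 (1972) §1.11 Prop. 12 [Serre1972]; cell: `O5/O5GlobalLine.lean`,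
HOME/b2b-bsdres-harvest-2/gen48/E102.
-/

set_option autoImplicit false

noncomputable section

open scoped Classical

open WeierstrassCurve Literature.NumberTheory.EllipticCurves
  Literature.NumberTheory.EllipticCurves.Rank1Residual
  Summit.BirchSwinnertonDyer.Rank1Residual.Additive

namespace Summit.BirchSwinnertonDyer.Rank1Residual.O5

/-! ## §1 The parity input `hpar` from the `p`-Selmer parity fact, for `LocIrr` curves at `3` -/

/-- Arithmetic of powers of `3`: `3 ^ s = 9 ^ k` for some `k` iff `s` is even. [folklore] -/
theorem exists_pow_three_eq_pow_nine_iff (s : ℕ) : (∃ k : ℕ, (3 : ℕ) ^ s = 9 ^ k) ↔ Even s := by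
  constructor
  · rintro ⟨k, hk⟩
    have h9 : (9 : ℕ) ^ k = 3 ^ (2 * k) := by rw [pow_mul]; norm_num
    have hs : s = 2 * k := Nat.pow_right_injective (by norm_num : 2 ≤ 3) (hk.trans h9)
    exact ⟨k, by omega⟩
  · rintro ⟨k, hk⟩
    exact ⟨k, by rw [hk, ← two_mul, pow_mul]; norm_num⟩

/-- **`hpar` from the `p`-Selmer parity theorem.** Granted the tree's named fact
`even_selmerRank_sub_torsionRank_iff` (Dokchitser–Dokchitser 2010 Thm. 1.4 in `p`-Selmer form), a
curve `E/ℚ` with `E[3]|G_{ℚ₃}` irreducible — hence `E(ℚ)[3] = 0`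
(`Additive.natCard_torsionBy_eq_one_of_locIrr`) — has `w(E) = 1` iff `#Sel₃(E)` is a power of `9`
(iff `dim_{𝔽₃} Sel₃(E)` is even). [cite: DokchitserDokchitserAnnals2010, Thm 1.4]
[cite: BhargavaShankarTernary2015, Thm 42] -/
theorem rootNumber_eq_one_iff_of_locIrr_three (hDD : even_selmerRank_sub_torsionRank_iff)
    (E : WeierstrassCurve ℚ) [E.IsElliptic] (hL : LocIrr E 3) :
    E.rootNumber = 1 ↔ ∃ k : ℕ, Nat.card (E.selmerGroup 3) = 9 ^ k := by
  obtain ⟨s, hs⟩ := exists_natCard_selmerGroup_eq_pow E 3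
  have ht : Nat.card (AddSubgroup.torsionBy E.toAffine.Point ((3 : ℕ) : ℤ)) = 3 ^ 0 := by
    rw [pow_zero]
    exact natCard_torsionBy_eq_one_of_locIrr E 3 hL
  have hpar := hDD E 3 s 0 hs ht
  rw [Nat.cast_zero, sub_zero, Int.even_coe_nat] at hpar
  rw [Nat.cast_ofNat] at hs
  rw [← hpar, hs, exists_pow_three_eq_pow_nine_iff]

/-- The same in the `∀`-shape of the binder `hpar` of `rootNumberTwisted_of_jump`. [folklore] -/
theorem hpar_of_selmerParity (hDD : even_selmerRank_sub_torsionRank_iff) :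
    ∀ (E : WeierstrassCurve ℚ) [E.IsElliptic] [E.IsGloballyMinimal], LocIrr E 3 →
      (E.rootNumber = 1 ↔ ∃ k : ℕ, Nat.card (E.selmerGroup 3) = 9 ^ k) :=
  fun E _ _ hL ↦ rootNumber_eq_one_iff_of_locIrr_three hDD E hL

/-! ## §2 T23b ⟹ T23c granted the parity fact alone -/

/-- **T23b ⟹ T23c, binders discharged.** Granted the registered `p`-Selmer parity fact
`even_selmerRank_sub_torsionRank_iff` [cite: DokchitserDokchitserAnnals2010, Thm 1.4], the node
`SelmerJumpTwistedClassesThree` (T23b) implies `RootNumberTwistedClassesThree` (T23c): the edge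
`rootNumberTwisted_of_jump` of `O5/O5GlobalLine.lean` with `hpow := exists_natCard_selmerGroup_eq_pow`
(tree theorem), `hgss := Additive.locIrr_three_of_classO5_of_subGss` (tree theorem, part 1/2), and
`hpar` from §1. [cite: Serre1972, §1.11 Prop. 12] -/
theorem rootNumberTwisted_of_jump_of_selmerParity (hDD : even_selmerRank_sub_torsionRank_iff)
    (hjump : SelmerJumpTwistedClassesThree) : RootNumberTwistedClassesThree :=
  rootNumberTwisted_of_jump (fun E _ _ ↦ exists_natCard_selmerGroup_eq_pow E 3)
    (hpar_of_selmerParity hDD) (fun E _ _ hO hG ↦ locIrr_three_of_classO5_of_subGss E hO hG) hjump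

/-! ## §3 T23a ⟹ T23c′ granted the parity fact (both members `LocIrr`) -/

/-- Arithmetic: two powers of `3` that are EQUAL are simultaneously powers of `9` or not, so the
two root numbers read through `hpar` agree. [folklore] -/
theorem rootNumber_eq_of_card_eq {a b : ℕ} {w v : ℤ} (hw : w = 1 ∨ w = -1) (hv : v = 1 ∨ v = -1)
    (hpa : w = 1 ↔ ∃ k : ℕ, a = 9 ^ k) (hpb : v = 1 ↔ ∃ k : ℕ, b = 9 ^ k) (hab : a = b) : w = v := by
  subst hab
  rcases hw with rfl | rfl <;> rcases hv with rfl | rfl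
  · rfl
  · exact absurd (hpb.mpr (hpa.mp rfl)) (by norm_num)
  · exact absurd (hpa.mpr (hpb.mp rfl)) (by norm_num)
  · rfl

/-- **T23a ⟹ T23c′ for pairs with BOTH members locally irreducible at `3`**, granted the parity fact:
equal `#Sel₃` (T23a `SelmerTransferTameClassThree`) and `hpar` on both sides give equal root numbers.
The node `RootNumberTameClassThree` lists `LocIrr W 3` only; here `LocIrr X 3` is an explicit extra
binder (see `rootNumberTame_of_transfer_of_selmerParity_of_subGss` for the I₀* class, where it is
automatic). [cite: DokchitserDokchitserAnnals2010, Thm 1.4] -/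
theorem rootNumberTame_of_transfer_of_selmerParity (hDD : even_selmerRank_sub_torsionRank_iff)
    (htr : SelmerTransferTameClassThree)
    (W X : WeierstrassCurve ℚ) [W.IsElliptic] [W.IsGloballyMinimal] [X.IsElliptic] [X.IsGloballyMinimal]
    (hOW : ClassO5 W 3) (hOX : ClassO5 X 3) (hLW : LocIrr W 3) (hirr : W.HasIrreducibleModPGaloisRep 3)
    (hv : padicValRat 3 W.Δ = padicValRat 3 X.Δ) (hc : IsCongruentModThree W X)
    (hcl : IsCleanPairAwayFromThree W X) (hLX : LocIrr X 3) : W.rootNumber = X.rootNumber :=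
  rootNumber_eq_of_card_eq (rootNumber_eq_one_or W) (rootNumber_eq_one_or X)
    (rootNumber_eq_one_iff_of_locIrr_three hDD W hLW) (rootNumber_eq_one_iff_of_locIrr_three hDD X hLX)
    (htr W X hOW hOX hLW hirr hv hc hcl)

/-- **T23a ⟹ T23c′ on the I₀* class**: when `X` is on `(G) ∧ ss` (`SubGss X 3`), `LocIrr X 3` is the
tree theorem `Additive.locIrr_three_of_classO5_of_subGss` and the extra binder disappears.
[cite: Serre1972, §1.11 Prop. 12] [cite: DokchitserDokchitserAnnals2010, Thm 1.4] -/
theorem rootNumberTame_of_transfer_of_selmerParity_of_subGss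
    (hDD : even_selmerRank_sub_torsionRank_iff) (htr : SelmerTransferTameClassThree)
    (W X : WeierstrassCurve ℚ) [W.IsElliptic] [W.IsGloballyMinimal] [X.IsElliptic] [X.IsGloballyMinimal]
    (hOW : ClassO5 W 3) (hOX : ClassO5 X 3) (hLW : LocIrr W 3) (hirr : W.HasIrreducibleModPGaloisRep 3)
    (hv : padicValRat 3 W.Δ = padicValRat 3 X.Δ) (hc : IsCongruentModThree W X)
    (hcl : IsCleanPairAwayFromThree W X) (hGX : SubGss X 3) : W.rootNumber = X.rootNumber :=
  rootNumberTame_of_transfer_of_selmerParity hDD htr W X hOW hOX hLW hirr hv hc hcl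
    (locIrr_three_of_classO5_of_subGss X hOX hGX)

/-- The redundant hypothesis of the O5 nodes: in T23a / T23b / T23c / T23c′ / T23d the binder
`W.HasIrreducibleModPGaloisRep 3` follows from `LocIrr W 3` (`Additive.irr_three_of_locIrr_three`);
recorded as the T23c′-shaped statement with that hypothesis DROPPED, granted T23a and parity, both
members `LocIrr`. [folklore] -/
theorem rootNumberTame_of_transfer_of_selmerParity' (hDD : even_selmerRank_sub_torsionRank_iff)
    (htr : SelmerTransferTameClassThree)
    (W X : WeierstrassCurve ℚ) [W.IsElliptic] [W.IsGloballyMinimal] [X.IsElliptic] [X.IsGloballyMinimal]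
    (hOW : ClassO5 W 3) (hOX : ClassO5 X 3) (hLW : LocIrr W 3) (hLX : LocIrr X 3)
    (hv : padicValRat 3 W.Δ = padicValRat 3 X.Δ) (hc : IsCongruentModThree W X)
    (hcl : IsCleanPairAwayFromThree W X) : W.rootNumber = X.rootNumber :=
  rootNumberTame_of_transfer_of_selmerParity hDD htr W X hOW hOX hLW (irr_three_of_locIrr_three W hLW)
    hv hc hcl hLX

/-! ## §4 The same edges from the node's own listed inputs: `p_parity` (corank form) + Cassels–Tate -/

/-- **T23b ⟹ T23c granted `p_parity` and the Cassels–Tate pairing** — exactly the inputs the node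
`RootNumberTwistedClassesThree` lists for `hpar` ("Cassels–Tate [MazurRubin2007, Prop. 2.1] + 3-parity
[DokchitserDokchitserAnnals2010, Thm. 1.4]"): the tree's `even_selmerRank_sub_torsionRank_iff_of_facts`
turns the corank-form `p`-parity fact `p_parity` (bsd.S19) and `exists_casselsTate_pairing` (bsd.S18,
registry A24) into the `p`-Selmer form consumed by `rootNumberTwisted_of_jump_of_selmerParity`.
[cite: DokchitserDokchitserAnnals2010, Thm. 1.4] [cite: MazurRubin2007, Prop. 2.1] -/
theorem rootNumberTwisted_of_jump_of_pParity
    (hpp : ∀ (E : WeierstrassCurve ℚ) [E.IsElliptic] (p : ℕ) [Fact p.Prime], p_parity E p)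
    (hCT : WeierstrassCurve.exists_casselsTate_pairing (K := ℚ))
    (hjump : SelmerJumpTwistedClassesThree) : RootNumberTwistedClassesThree :=
  rootNumberTwisted_of_jump_of_selmerParity (even_selmerRank_sub_torsionRank_iff_of_facts hpp hCT) hjump

/-- `hpar` for a single `LocIrr` curve at `3` from `p_parity` + Cassels–Tate. [cite: DokchitserDokchitserAnnals2010, Thm. 1.4]
[cite: MazurRubin2007, Prop. 2.1] -/
theorem rootNumber_eq_one_iff_of_locIrr_three_of_pParity
    (hpp : ∀ (E : WeierstrassCurve ℚ) [E.IsElliptic] (p : ℕ) [Fact p.Prime], p_parity E p)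
    (hCT : WeierstrassCurve.exists_casselsTate_pairing (K := ℚ))
    (E : WeierstrassCurve ℚ) [E.IsElliptic] (hL : LocIrr E 3) :
    E.rootNumber = 1 ↔ ∃ k : ℕ, Nat.card (E.selmerGroup 3) = 9 ^ k :=
  rootNumber_eq_one_iff_of_locIrr_three (even_selmerRank_sub_torsionRank_iff_of_facts hpp hCT) E hL

/-- **T23a ⟹ T23c′ on the I₀* class granted `p_parity` and Cassels–Tate** (both members `LocIrr`,
the second automatically). [cite: DokchitserDokchitserAnnals2010, Thm. 1.4] [cite: MazurRubin2007, Prop. 2.1] -/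
theorem rootNumberTame_of_transfer_of_pParity_of_subGss
    (hpp : ∀ (E : WeierstrassCurve ℚ) [E.IsElliptic] (p : ℕ) [Fact p.Prime], p_parity E p)
    (hCT : WeierstrassCurve.exists_casselsTate_pairing (K := ℚ)) (htr : SelmerTransferTameClassThree)
    (W X : WeierstrassCurve ℚ) [W.IsElliptic] [W.IsGloballyMinimal] [X.IsElliptic] [X.IsGloballyMinimal]
    (hOW : ClassO5 W 3) (hOX : ClassO5 X 3) (hLW : LocIrr W 3) (hirr : W.HasIrreducibleModPGaloisRep 3)
    (hv : padicValRat 3 W.Δ = padicValRat 3 X.Δ) (hc : IsCongruentModThree W X)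
    (hcl : IsCleanPairAwayFromThree W X) (hGX : SubGss X 3) : W.rootNumber = X.rootNumber :=
  rootNumberTame_of_transfer_of_selmerParity_of_subGss
    (even_selmerRank_sub_torsionRank_iff_of_facts hpp hCT) htr W X hOW hOX hLW hirr hv hc hcl hGX

end Summit.BirchSwinnertonDyer.Rank1Residual.O5

end
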